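import Summits.QuantumAdvantage.QuantumAdvantage.Theses.LinnikCubicClassGroups
import Literature.Computability.Cryptography.HallgrenRegulatorGenericSampling
import Literature.Computability.Cryptography.HallgrenRegulatorGenericPost

/-!
# Crux `LinnikCubicClassGroups.PureCubicClassGroupFBQP` (stmt-QuantumAdvantage-11544) — stub `stub_regulatorGeneric`

Line `arakelov-giant-step-cycle`, stub `stub_regulatorGeneric` (S3b-T2): **Hallgren's regulator theorem for
ANY family of `GiantStepCycle`s** indexed by admissible inputs whose walk table `tab` and candidate test
`passes` are ONE polynomial-time program each (Jozsa 2003, §10 Thm. 6–7, made abstract in the instance; the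
generic content of the tree's `HallgrenPellQuantum.lean`). Assembly of the tree's generic bricks
`HallgrenRegulatorGenericSampling.lean` (parts I–II) and `HallgrenRegulatorGenericPost.lean` (parts III–IV):

1. the quantum core is the shift experiment `hallgrenSS.family` on the table program (oracle-free, uniform by
   `family_isUniform … hallgrenGE`, read-out law `kernelProb_family` = the product of Kitaev's per-unit laws);
2. on an admissible input `w` (bundle `G, eι, s₀, M` with the listed numeric facts) the table read on `[0, Q)`
   is an injective re-coding of a blurred gap table (part I, `exists_blurred_gen`), so every small harmonic
   `⌊kQ/S⌉`, `1 ≤ k ≤ ⌊S/210⌋`, is heavy (`corrMass_ck_ge_gen`) and some of the `2^43` pairs of units reads a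
   coprime pair of small harmonics with probability `≥ 4/5` (part II, `prob_exists_goodPair_gen`);
3. on that event the candidate list contains an accepted candidate within `1` of `S = N R` and the least
   accepted candidate `m₀` is within `10` of `S` (part III), so the post-processor `g ∈ FP` (part IV) outputs
   `⟨bin m₀, ε⟩`; off the promise nothing is required;
4. `isQSolvable_classicalWrap_holds` (Bernstein–Vazirani) wraps the family with `g`, and `IsQSolvable.mono`
   passes to the stated relation (`⟨bin m₀, ε⟩ ++ t = ⟨bin m₀, t⟩`).
-/

-- the problem namespace repeats the summit name (`QuantumAdvantage.QuantumAdvantage`)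
set_option linter.dupNamespace false

namespace Summit.QuantumAdvantage.QuantumAdvantage.Theorems.LinnikCubicClassGroups

open Computability (encodeNat decodeNat)
open Literature.Computability.Cryptography (IsQSolvable GiantStepCycle WalkData QCircuitFamily cliffordT
  isQSolvable_classicalWrap_holds)
open Literature.Computability.Cryptography.HallgrenQuantum
open Literature.Computability.Cryptography.PeriodFinding
open Literature.Computability.Cryptography.ShiftSampling
open Literature.Computability.Complexity (boolPair CodeFP FP)
open Literature.Computability.Complexity.CodeFP (pairE strE natE intE bitE unE pairE_injective intE_injective)
open Finset

-- this linter exhausts the recursion depth on the `2^44`-unit read-out type (as on `HallgrenQuantum.kernelProb_R₀_ge`)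
set_option linter.constructorNameAsVariable false in
/-- **The quantum core succeeds with probability `≥ 2/3` on every input**: on input `w`, the shift experiment on
the table program outputs, with probability `≥ 2/3`, a measured string `v` on which — if `w` is admissible —
the post-processor writes `⟨bin m₀, ε⟩` with `|m₀ − N ρ| ≤ 10` (the linter `constructorNameAsVariable` is
disabled on this declaration, as on `HallgrenQuantum.kernelProb_R₀_ge`: it exhausts the recursion depth on the
success event's `Finset` over the `2^44`-unit read-out type). -/
theorem kernelProb_ge_gen (tab : List Bool → ℕ → List Bool) (passes : List Bool → ℕ → Bool)
    (htab : CodeFP (pairE strE natE) strE (fun p => tab p.1 p.2)) (w : List Bool) (Adm : Prop) (ρw : ℝ)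
    (hbundle : Adm → ∃ (ι : Type) (eι : ι → List Bool) (G : GiantStepCycle ι) (s₀ M : ℕ),
        Function.Injective eι ∧ G.R = ρw ∧
        (∀ v : ℕ, v < 2 ^ LQ w.length →
          tab w v = pairE eι intE (G.table (Ngrid w.length) s₀ (Tdbl w.length) (2 * M) (v : ℤ))) ∧
        (∀ m : ℕ, passes w m = true ↔
          G.Passes (((m : ℤ) : ℚ) / (Ngrid w.length : ℚ)) ((4 : ℚ) / (Ngrid w.length : ℚ)) s₀ (Tdbl w.length) (2 * M)) ∧
        2 * G.K + 1 ≤ (G.start s₀).2 ∧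
        G.Res s₀ (Tdbl w.length) < M * (G.L - 2 * G.η) ∧
        (Ngrid w.length : ℝ) * (G.Etot s₀ (Tdbl w.length) (2 * M) + 2 * G.η) ≤ 2 ∧
        (5000 : ℝ) ≤ Ngrid w.length * G.R ∧
        3 * ((Ngrid w.length : ℝ) * G.R) ^ 2 ≤ (2 : ℝ) ^ LQ w.length ∧
        (51 : ℝ) * G.n + 7 ≤ 3 * ((Ngrid w.length : ℝ) * G.R) / 4 ∧
        (1 : ℝ) / 16 ≤ G.L)
    (g : List Bool → List Bool)
    (hge : ∀ v : List Bool, g (boolPair w v) =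
      if (minAcc ((allCands w.length v).filter (fun m => decide (12 ≤ m) && passes w m))).1 then
        boolPair (encodeNat (minAcc ((allCands w.length v).filter (fun m => decide (12 ≤ m) && passes w m))).2) []
      else []) :
    2 / 3 ≤ (hallgrenSS.family (hallgrenSS.blockFn_mem_FP nU_un L_un Lv_un B_un htab)).kernelProb 0 w
      {v | Adm → ∃ m : ℕ, |(m : ℝ) - Ngrid w.length * ρw| ≤ 10 ∧ g (boolPair w v) = boolPair (encodeNat m) []} := by
  by_cases hadm : Adm
  · obtain ⟨ι, eι, G, s₀, M, hinj, hR, htabw, hpassw, hstart, hRes, hEtot, hS, hQ3, hn51, hL16⟩ := hbundle hadm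
    -- the table on `[0, Q)` is an injective re-coding of a blurred gap table
    obtain ⟨Tb, hTS, hTn, hw1, hw3, he0, he2, hFN⟩ := exists_blurred_gen G w.length s₀ M hstart hRes hEtot
    have hF : ∀ v < 2 ^ LQ w.length, ∀ v' < 2 ^ LQ w.length, (tab w v = tab w v' ↔ Tb.FN v = Tb.FN v') := by
      intro v hv v' hv'
      rw [htabw v hv, htabw v' hv', hFN v hv, hFN v' hv']
      exact ⟨fun h => pairE_injective hinj intE_injective h, fun h => by rw [h]⟩
    -- the small harmonics `⌊kQ/S⌉`, `1 ≤ k ≤ Kh = ⌊S/210⌋`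
    obtain ⟨hKh1, hKh2⟩ := Kh_bounds_gen hS
    have hck : ∀ k ∈ Icc 1 ⌊Ngrid w.length * G.R / 210⌋₊,
        (round ((k : ℝ) * (2 : ℝ) ^ LQ w.length / (Ngrid w.length * G.R))).toNat < 2 ^ LQ w.length ∧
        |(((round ((k : ℝ) * (2 : ℝ) ^ LQ w.length / (Ngrid w.length * G.R))).toNat : ℕ) : ℝ) -
          k * (2 : ℝ) ^ LQ w.length / (Ngrid w.length * G.R)| ≤ 1 / 2 :=
      fun k hk => (ck_spec_gen w.length hS hKh2 hk).2
    have hinjck := ck_injOn_gen w.length hS hQ3 hck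
    -- every small harmonic is heavy
    have hS' : 5000 ≤ Tb.S := by rw [hTS]; exact hS
    have hQ3' : 3 * Tb.S ^ 2 ≤ (2 : ℝ) ^ LQ w.length := by rw [hTS]; exact hQ3
    have hn' : 51 * (Tb.n : ℝ) + 7 ≤ 3 * Tb.S / 4 := by rw [hTS, hTn]; exact hn51
    have hKh' : ((⌊Ngrid w.length * G.R / 210⌋₊ : ℕ) : ℝ) ≤ Tb.S / 210 := by rw [hTS]; exact hKh2
    have hmass : ∀ k ∈ Icc 1 ⌊Ngrid w.length * G.R / 210⌋₊,
        ((2 : ℝ) ^ LQ w.length) ^ 2 / (2304 * (Ngrid w.length * G.R)) ≤ corrMass (2 ^ LQ w.length) (tab w)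
          ((round ((k : ℝ) * (2 : ℝ) ^ LQ w.length / (Ngrid w.length * G.R))).toNat) := by
      intro k hk
      have hc := (hck k hk).2
      rw [← hTS] at hc ⊢
      exact corrMass_ck_ge_gen Tb w.length (tab w) hF hS' hQ3' hw1 hw3 he0 he2 hn' hKh' hk hc
    -- the success event: some pair of units reads a coprime pair of small harmonics
    have hE := prob_exists_goodPair_gen w (tab w) hS hKh1 hinjck (fun k hk => (hck k hk).1) hmass
    set C := ((Icc 1 ⌊Ngrid w.length * G.R / 210⌋₊) ×ˢ (Icc 1 ⌊Ngrid w.length * G.R / 210⌋₊)).filter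
      (fun kl : ℕ × ℕ => Nat.Coprime kl.1 kl.2) with hC
    set E : Finset (hallgrenSS.Readout w.length) := univ.filter fun γ => ∃ i : Fin NPAIRS, ∃ kk ∈ C,
      cEst (Qof (Lux (x := w)) (ua i)) (γ (ua i)) = (round ((kk.1 : ℝ) * (2 : ℝ) ^ LQ w.length / (Ngrid w.length * G.R))).toNat ∧
      cEst (Qof (Lux (x := w)) (ub i)) (γ (ub i)) = (round ((kk.2 : ℝ) * (2 : ℝ) ^ LQ w.length / (Ngrid w.length * G.R))).toNat
      with hEdef
    have hk := hallgrenSS.kernelProb_family (hallgrenSS.blockFn_mem_FP nU_un L_un Lv_un B_un htab) w E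
    -- on the success event the post-processor is correct
    have hsub : {v : List Bool | hallgrenSS.readOf w.length v ∈ E} ⊆
        {v | Adm → ∃ m : ℕ, |(m : ℝ) - Ngrid w.length * ρw| ≤ 10 ∧ g (boolPair w v) = boolPair (encodeNat m) []} := by
      intro v hv _
      rw [Set.mem_setOf_eq, hEdef, mem_filter] at hv
      obtain ⟨i, kk, hkk, hca, hcb⟩ := hv.2
      have hc : hallgrenSS.charOf w.length v (2 * (i : ℕ)) =
          (round ((kk.1 : ℝ) * (2 : ℝ) ^ LQ w.length / (Ngrid w.length * G.R))).toNat :=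
        (hallgrenSS.charOf_eq w.length v (ua i)).trans hca
      have hd : hallgrenSS.charOf w.length v (2 * (i : ℕ) + 1) =
          (round ((kk.2 : ℝ) * (2 : ℝ) ^ LQ w.length / (Ngrid w.length * G.R))).toNat :=
        (hallgrenSS.charOf_eq w.length v (ub i)).trans hcb
      obtain ⟨m, hmem, hclose⟩ := exists_good_cand_gen w.length hS hQ3 hKh2 hck i.isLt hkk hc hd
      have hacc := acc_complete_gen G w.length s₀ M (passes w) hpassw hstart hRes hEtot hS hQ3 hL16 hclose
      obtain ⟨m₀, hsel, hm₀⟩ := post_correct_gen hS (fun m => decide (12 ≤ m) && passes w m)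
        (fun m hm => acc_sound_gen G w.length s₀ M (passes w) hpassw hEtot hm) ⟨m, hmem, hacc, hclose⟩
      refine ⟨m₀, by rw [← hR]; exact hm₀, ?_⟩
      rw [hge v, hsel]
      simp
    calc (2 : ℝ) / 3 ≤ 4 / 5 := by norm_num
      _ ≤ _ := hE
      _ = (hallgrenSS.family (hallgrenSS.blockFn_mem_FP nU_un L_un Lv_un B_un htab)).kernelProb 0 w
            {v : List Bool | hallgrenSS.readOf w.length v ∈ E} := hk.symm
      _ ≤ _ := kernelProb_mono _ _ hsub
  · -- off the promise the relation is everything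
    have huniv : {v : List Bool | Adm → ∃ m : ℕ, |(m : ℝ) - Ngrid w.length * ρw| ≤ 10 ∧
        g (boolPair w v) = boolPair (encodeNat m) []} = Set.univ :=
      Set.eq_univ_of_forall fun v h => absurd h hadm
    have hk := hallgrenSS.kernelProb_family (hallgrenSS.blockFn_mem_FP nU_un L_un Lv_un B_un htab) w univ
    rw [huniv]
    have hset : {v : List Bool | hallgrenSS.readOf w.length v ∈ (univ : Finset (hallgrenSS.Readout w.length))} = Set.univ := by
      ext v; simp
    rw [hset] at hk
    rw [hk, prob_univ (unitLaw_isProbVec _ _)]; norm_num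

/-- **S3b-T2 `stub_regulatorGeneric`** (Hallgren's regulator theorem, generic in the infrastructure; Jozsa 2003
§10 Thm. 6–7): for polynomial-time programs `tab` (walk table) and `passes` (candidate test) such that every
admissible input carries a `GiantStepCycle` with an injective label coding, adequate walk parameters and the
numeric side conditions of the Fourier analysis, the relation "on admissible `w`, output `⟨bin m, ·⟩` with
`|m − N·ρ w| ≤ 10`" is `IsQSolvable`. -/
theorem stub_regulatorGeneric :
    ∀ (tab : List Bool → ℕ → List Bool) (passes : List Bool → ℕ → Bool)
      (Adm : List Bool → Prop) (ρ : List Bool → ℝ),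
      CodeFP (pairE strE natE) strE (fun p => tab p.1 p.2) →
      CodeFP (pairE strE natE) bitE (fun p => passes p.1 p.2) →
      (∀ w : List Bool, Adm w → ∃ (ι : Type) (eι : ι → List Bool) (G : GiantStepCycle ι) (s₀ M : ℕ),
        Function.Injective eι ∧ G.R = ρ w ∧
        (∀ v : ℕ, v < 2 ^ LQ w.length →
          tab w v = pairE eι intE (G.table (Ngrid w.length) s₀ (Tdbl w.length) (2 * M) (v : ℤ))) ∧
        (∀ m : ℕ, passes w m = true ↔
          G.Passes (((m : ℤ) : ℚ) / (Ngrid w.length : ℚ)) ((4 : ℚ) / (Ngrid w.length : ℚ)) s₀ (Tdbl w.length) (2 * M)) ∧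
        2 * G.K + 1 ≤ (G.start s₀).2 ∧
        G.Res s₀ (Tdbl w.length) < M * (G.L - 2 * G.η) ∧
        (Ngrid w.length : ℝ) * (G.Etot s₀ (Tdbl w.length) (2 * M) + 2 * G.η) ≤ 2 ∧
        (5000 : ℝ) ≤ Ngrid w.length * G.R ∧
        3 * ((Ngrid w.length : ℝ) * G.R) ^ 2 ≤ (2 : ℝ) ^ LQ w.length ∧
        (51 : ℝ) * G.n + 7 ≤ 3 * ((Ngrid w.length : ℝ) * G.R) / 4 ∧
        (1 : ℝ) / 16 ≤ G.L) →
      IsQSolvable fun w => {y | Adm w → ∃ (m : ℕ) (t : List Bool),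
        y = boolPair (encodeNat m) t ∧ |(m : ℝ) - Ngrid w.length * ρ w| ≤ 10} := by
  intro tab passes Adm ρ htab hpasses hAdm
  -- the post-processor (part IV)
  obtain ⟨g, hg, hge⟩ := exists_post_fn_gen hpasses
  -- the base relation is solvable by the quantum core
  have hR₀ : IsQSolvable fun w => {v | Adm w → ∃ m : ℕ, |(m : ℝ) - Ngrid w.length * ρ w| ≤ 10 ∧
      g (boolPair w v) = boolPair (encodeNat m) []} :=
    ⟨hallgrenSS.family (hallgrenSS.blockFn_mem_FP nU_un L_un Lv_un B_un htab), hallgrenSS.family_isOracleFree _,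
      hallgrenSS.family_isUniform (hallgrenSS.blockFn_mem_FP nU_un L_un Lv_un B_un htab) hallgrenGE,
      fun w => kernelProb_ge_gen tab passes htab w (Adm w) (ρ w) (hAdm w) g (hge w)⟩
  -- classical wrap (identity pre-processor, post-processor `g`)
  have hid : (fun w : List Bool => w) ∈ FP := Literature.Computability.Complexity.PolyTimeComputable.id _
  have h := isQSolvable_classicalWrap_holds (fun w => w) g hid hg hR₀
  refine h.mono fun w z hz => ?_
  obtain ⟨y, hy, hpre⟩ := hz
  intro hadm
  obtain ⟨m, hm, hpost⟩ := hy hadm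
  rw [hpost] at hpre
  obtain ⟨t, rfl⟩ := hpre
  exact ⟨m, t, by simp [Literature.Computability.Complexity.boolPair], hm⟩

end Summit.QuantumAdvantage.QuantumAdvantage.Theorems.LinnikCubicClassGroups
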